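import Mathlib
import Summits.NavierStokesRegularity.NavierStokesRegularity.Theorems.EulerZoomLiouvillePowerGaugeEulerLiouvilleDSSSwirlRatchet
import Summits.NavierStokesRegularity.NavierStokesRegularity.Theorems.EulerZoomLiouvillePowerGaugeEulerLiouvilleSelfSimilarSwirlCasimir
import Literature.Analysis.FluidPDE.ParticleTrajectoryMeasurePreserving
import Literature.Analysis.ODE.EvolutionMapAutonomous
import HarnessLib

/-!
# Crux E `PowerGaugeEulerLiouville` (stmt-NavierStokesRegularity-19832): THE DISCRETE SWIRL CASIMIR — a classical axisymmetric DSS member whose swirl has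
# FINITE-VOLUME SUPPORT or ONE FINITE `L^q` CASIMIR WITH `qρ ≠ 3` on ONE past slice is swirl-free (width seat ns-ezl-w3 g3)

Route №10 `EulerZoomLiouville` (NavierStokesRegularity), crux E; LEAD ns-typeII-p2 g12; the axisymmetric DSS branch of `stub_nonSelfSimilarRest`
(`IsDSSClassicalTame ρ u p`: ns-typeII-p3's `AxisymNoSwirl.ae_eq_zero_of_gauge_of_axisym_dss` asks for the swirl Casimir `(r u_θ)^k ∈ L²` for ONE INTEGER `k ≥ 1` with
`2kρ ≠ 3`, UNIFORMLY on compact past intervals).  Sequel to `…DSSSwirlRatchet` (bounded swirl on one slice).  Here the DISTRIBUTION FUNCTION of the swirl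
`m_τ(μ) = vol{y | μ < |Γ(τ,y)|}`, `Γ(τ,·) = swirl (u τ)`, is read through the two symmetries of the member:

* TRANSPORT (`DSSSwirlRatchet.swirl_eq_swirl_evolutionMap`, `Γ(τ, x) = Γ(τ′, φ(τ → τ′) x)`) + INCOMPRESSIBILITY (the two-time particle-trajectory maps
  preserve Lebesgue measure — `DSSSwirlRatchet.measurePreserving_evolutionMap_past`, the tree's MB §1.3 Prop. 1.4 moved to the past window `(−∞,0)` by a time shift)
  ⇒ **`m_τ = m_{τ′}` for all `τ, τ′ < 0`** (`volume_superlevel_swirl_eq`).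
* DSS (`swirl_dss_down`: `Γ(τ, z) = l^{−ρ} Γ(l^{−(2+ρ)}τ, l⁻¹z)`) ⇒ `m_τ(μ) = l³ · m(l^ρ μ)` (`volume_superlevel_swirl_dss_step`), hence for every `k : ℕ`
  **`m(μ) = l^{3k} m(l^{kρ} μ)`** and **`m(l^{−kρ} μ) = l^{3k} m(μ)`** (`volume_superlevel_swirl_dss_iterate`, `…_iterate_down`).
* KILLS (`eq_zero_of_geometric_ratchet`: `b^k · v ≤ I < ∞` for all `k` with `b > 1` forces `v = 0`):
  finite-volume swirl support on one slice (`hasNoSwirl_of_dss_of_finiteSwirlSupport`: `l^{3k} m(μ) = m(l^{−kρ}μ) ≤ vol{Γ ≠ 0}`);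
  one finite Casimir `∫⁻ |Γ(τ₀,·)|^q < ∞`, `0 < q`, `qρ ≠ 3` (`hasNoSwirl_of_dss_of_swirl_Lq`: Chebyshev gives `μ^q (l^{|3−qρ|})^k m(μ) ≤ ∫|Γ|^q` on the side
  `k → +∞` if `qρ > 3`, `k → −∞` if `qρ < 3`; `qρ = 3` is exactly the DSS-invariant Casimir and is NOT killed).
* MEMBER FORMS `ae_eq_zero_of_gauge_of_axisym_dss_finiteSwirlSupport`, `ae_eq_zero_of_gauge_of_axisym_dss_swirlCasimir`: `AxisymNoSwirl.ae_eq_zero_of_gauge_of_axisymNoSwirl_dss`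
  with its no-swirl clause supplied by the kills.  For the LEAD: in the axisymmetric disjunct of `IsDSSClassicalTame ρ u p` the Casimir clause may read
  `∃ τ₀ < 0, (vol{swirl (u τ₀) ≠ 0} < ⊤ ∨ ∃ B, |swirl (u τ₀)| ≤ B ∨ ∃ q > 0, qρ ≠ 3 ∧ ∫⁻ ofReal(|swirl (u τ₀)|^q) < ⊤)` — ONE slice, ANY real exponent off `3/ρ`
  (⊇ the v34 clause `∃ k ≥ 1, 2kρ ≠ 3, (r u_θ)^k ∈ L²` uniformly: take `q = 2k` on any one slice).

WHAT THIS IS NOT: not NS regularity, not the crux E — a widening of one DSS stratum of the crux CLASS 19832 (MODEL lattice; E/NS strata) `--supports` stmt-19832; the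
swirl-free DSS endgame still needs `ω_θ/r ∈ L²`; the DSS-critical Casimir `q = 3/ρ` stays open; 19832 OPEN.
[folklore; MajdaBertozziCUP2002 §1.3 Prop. 1.4, §1.6 (1.53), §1.7 Cor. 1.4 (iv); Chae2007CMPEuler Thm 2.2 + Note added p. 6 (the continuous-scaling original)]
-/

noncomputable section

-- flat `Theorems/<Route><Decl>…` files of one crux share the namespace of the crux (tree convention: `Summit.<S>.<S>.…`)
set_option linter.dupNamespace false

open MeasureTheory Set Filter Topology Metric Function InnerProductSpace
open scoped RealInnerProductSpace NNReal ENNReal ContDiff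

namespace Summit.NavierStokesRegularity.NavierStokesRegularity.Theorems.PowerGaugeEulerLiouville

open Literature.Analysis Literature.Analysis.FluidPDE Literature.Analysis.FunctionSpaces

namespace DSSSwirlRatchet

variable {u : ℝ → EuclideanSpace ℝ (Fin 3) → EuclideanSpace ℝ (Fin 3)} {p : ℝ → EuclideanSpace ℝ (Fin 3) → ℝ}

/-! ### Incompressibility on the past window: the two-time particle-trajectory maps preserve Lebesgue measure -/

/-- The Cauchy–Lipschitz hypotheses survive a time translation `s ↦ u (s + a)` (times `(· + a)⁻¹' S`). [cite: Teschl2012, Problem 1.8 (PDF p. 19)] -/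
theorem isUniformlyLipschitzOn_comp_add_right {E : Type*} [NormedAddCommGroup E] [NormedSpace ℝ E] {v : ℝ → E → E} {S : Set ℝ}
    (hL : ODE.IsUniformlyLipschitzOn v S) (a : ℝ) :
    ODE.IsUniformlyLipschitzOn (fun s => v (s + a)) ((· + a) ⁻¹' S) := by
  refine ⟨fun x => ?_, fun C hC hCS => ?_⟩
  · exact (hL.continuousOn x).comp (continuous_id.add continuous_const).continuousOn fun t ht => ht
  · obtain ⟨K, hK⟩ := hL.exists_lipschitzWith (hC.image (continuous_id.add continuous_const))
      (by rintro _ ⟨t, ht, rfl⟩; exact hCS ht)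
    exact ⟨K, fun t ht => hK (t + a) ⟨t, ht, rfl⟩⟩

/-- **The two-time particle-trajectory maps `φ(τ₁ → τ₂)` of a classical (Euler/NS) solution on the past window `(−∞, 0)` preserve Lebesgue measure**
(`τ₁, τ₂ < 0`; Cauchy–Lipschitz hypotheses on the velocity).  The tree's MB Prop. 1.4 is stated on time sets containing `0`; translate time by `τ₁`
(`IsClassicalNSSolutionOn.comp_add_right`, `ODE.evolutionMap_comp_add_right`). [cite: MajdaBertozziCUP2002, §1.3 Def. 1.1, Prop. 1.4 (ii) ⇒ (i) (held text p. 14)] -/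
theorem measurePreserving_evolutionMap_past {ν : ℝ} (hns : IsClassicalNSSolutionOn (Iio 0) ν 0 u p)
    (hL : ODE.IsUniformlyLipschitzOn u (Iio 0)) {τ₁ τ₂ : ℝ} (hτ₁ : τ₁ < 0) (hτ₂ : τ₂ < 0) :
    MeasurePreserving (ODE.evolutionMap u τ₁ τ₂) volume volume := by
  have hS : ((· + τ₁) ⁻¹' Iio (0 : ℝ)) = Iio (-τ₁) := by
    ext s; simp only [mem_preimage, mem_Iio]; constructor <;> intro h <;> linarith
  have hns' : IsClassicalNSSolutionOn (Iio (-τ₁)) ν (fun t => (0 : ℝ → EuclideanSpace ℝ (Fin 3) → EuclideanSpace ℝ (Fin 3)) (t + τ₁))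
      (fun t => u (t + τ₁)) (fun t => p (t + τ₁)) := hS ▸ hns.comp_add_right τ₁
  have hL' : ODE.IsUniformlyLipschitzOn (fun s => u (s + τ₁)) (Iio (-τ₁)) := hS ▸ isUniformlyLipschitzOn_comp_add_right hL τ₁
  have h0 : (0 : ℝ) ∈ Iio (-τ₁) := by simp only [mem_Iio]; linarith
  have ht₁ : τ₁ - τ₁ ∈ Iio (-τ₁) := by simp only [mem_Iio]; linarith
  have ht₂ : τ₂ - τ₁ ∈ Iio (-τ₁) := by simp only [mem_Iio]; linarith
  have hmp := hns'.measurePreserving_evolutionMap (convex_Iio _) h0 (uniqueDiffOn_Iio _) hL' ht₁ ht₂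
  obtain ⟨K, hK⟩ := hL.exists_lipschitzWith_uIcc (convex_Iio 0) hτ₁ hτ₂
  have hfun : ODE.evolutionMap (fun s => u (s + τ₁)) (τ₁ - τ₁) (τ₂ - τ₁) = ODE.evolutionMap u τ₁ τ₂ := by
    funext x
    rw [ODE.evolutionMap_comp_add_right τ₁ (K := K) (by simpa only [sub_add_cancel] using hK) x]
    simp only [sub_add_cancel]
  rwa [hfun] at hmp

/-! ### The swirl distribution function is the same on every past slice -/

/-- **`vol{μ < |Γ(τ,·)|} = vol{μ < |Γ(τ′,·)|}` for all `τ, τ′ < 0`**: the superlevel set at time `τ` is the preimage of the one at time `τ′` under the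
measure-preserving map `φ(τ → τ′)` (`Γ(τ, x) = Γ(τ′, φ(τ → τ′) x)`). [cite: MajdaBertozziCUP2002, §1.7 Cor. 1.4 (iv) (held text p. 28), the same mechanism] -/
theorem volume_superlevel_swirl_eq (hns : IsClassicalNSSolutionOn (Iio 0) 0 0 u p)
    (hax : ∀ τ : ℝ, τ < 0 → IsAxisymmetric (u τ)) (hL : ODE.IsUniformlyLipschitzOn u (Iio 0))
    {τ τ' : ℝ} (hτ : τ < 0) (hτ' : τ' < 0) (μ : ℝ) :
    volume {y : EuclideanSpace ℝ (Fin 3) | μ < |swirl (u τ) y|} = volume {y : EuclideanSpace ℝ (Fin 3) | μ < |swirl (u τ') y|} := by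
  have hset : {y : EuclideanSpace ℝ (Fin 3) | μ < |swirl (u τ) y|} =
      ODE.evolutionMap u τ τ' ⁻¹' {y | μ < |swirl (u τ') y|} := by
    ext y; simp only [mem_setOf_eq, mem_preimage]; rw [swirl_eq_swirl_evolutionMap hns hax hL hτ' hτ y]
  have hopen : IsOpen {y : EuclideanSpace ℝ (Fin 3) | μ < |swirl (u τ') y|} :=
    isOpen_lt continuous_const (continuous_abs.comp (contDiff_swirl (hns.contDiff_velocity hτ')).continuous)
  rw [hset]
  exact (measurePreserving_evolutionMap_past hns hL hτ hτ').measure_preimage hopen.measurableSet.nullMeasurableSet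

/-! ### The DSS law of the distribution function -/

/-- **One DSS step: `vol{μ < |Γ(τ,·)|} = l³ · vol{l^ρ μ < |Γ(τ,·)|}`** (`swirl_dss_down` makes the left set the `l⁻¹`-homothetic preimage of the superlevel set
`{l^ρ μ < |Γ(σ,·)|}` at the later time `σ = l^{−(2+ρ)}τ`, of volume `l³` times it; then slice independence). [folklore] -/
theorem volume_superlevel_swirl_dss_step {ρ : ℝ} (hns : IsClassicalNSSolutionOn (Iio 0) 0 0 u p)
    (hax : ∀ τ : ℝ, τ < 0 → IsAxisymmetric (u τ)) (hL : ODE.IsUniformlyLipschitzOn u (Iio 0))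
    {l : ℝ} (hl : 1 < l) (hdss : ∀ τ : ℝ, τ < 0 → ∀ y, u τ y = (l ^ (1 + ρ)) • u ((l ^ (2 + ρ)) * τ) (l • y))
    {τ : ℝ} (hτ : τ < 0) (μ : ℝ) :
    volume {y : EuclideanSpace ℝ (Fin 3) | μ < |swirl (u τ) y|} =
      ENNReal.ofReal (l ^ (3 : ℕ)) * volume {y : EuclideanSpace ℝ (Fin 3) | l ^ ρ * μ < |swirl (u τ) y|} := by
  have hl0 : 0 < l := by linarith
  have hlρ : 0 < l ^ ρ := Real.rpow_pos_of_pos hl0 _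
  have hl2 : 0 < l ^ (2 + ρ) := Real.rpow_pos_of_pos hl0 _
  set σ : ℝ := (l ^ (2 + ρ))⁻¹ * τ with hσ
  have hσ0 : σ < 0 := by rw [hσ]; exact mul_neg_of_pos_of_neg (inv_pos.2 hl2) hτ
  have hset : {y : EuclideanSpace ℝ (Fin 3) | μ < |swirl (u τ) y|} =
      (fun z : EuclideanSpace ℝ (Fin 3) => l⁻¹ • z) ⁻¹' {w | l ^ ρ * μ < |swirl (u σ) w|} := by
    ext z
    simp only [mem_setOf_eq, mem_preimage]
    rw [swirl_dss_down hl hdss hτ z, abs_mul, abs_inv, abs_of_pos hlρ, ← div_eq_inv_mul, lt_div_iff₀ hlρ, mul_comm]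
  rw [hset, Measure.addHaar_preimage_smul volume (inv_ne_zero hl0.ne'), finrank_euclideanSpace_fin, inv_pow, inv_inv,
    abs_of_pos (pow_pos hl0 3), volume_superlevel_swirl_eq hns hax hL hσ0 hτ]

/-- **`k` DSS steps up: `m(μ) = l^{3k} · m(l^{kρ} μ)`** (`m(μ) = vol{μ < |Γ(τ,·)|}`, any `τ < 0`). [folklore] -/
theorem volume_superlevel_swirl_dss_iterate {ρ : ℝ} (hns : IsClassicalNSSolutionOn (Iio 0) 0 0 u p)
    (hax : ∀ τ : ℝ, τ < 0 → IsAxisymmetric (u τ)) (hL : ODE.IsUniformlyLipschitzOn u (Iio 0))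
    {l : ℝ} (hl : 1 < l) (hdss : ∀ τ : ℝ, τ < 0 → ∀ y, u τ y = (l ^ (1 + ρ)) • u ((l ^ (2 + ρ)) * τ) (l • y))
    {τ : ℝ} (hτ : τ < 0) (k : ℕ) (μ : ℝ) :
    volume {y : EuclideanSpace ℝ (Fin 3) | μ < |swirl (u τ) y|} =
      ENNReal.ofReal ((l ^ (3 : ℕ)) ^ k) * volume {y : EuclideanSpace ℝ (Fin 3) | (l ^ ρ) ^ k * μ < |swirl (u τ) y|} := by
  induction k generalizing μ with
  | zero => simp only [pow_zero, ENNReal.ofReal_one, one_mul]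
  | succ k ih =>
    have hl3 : 0 ≤ l ^ (3 : ℕ) := pow_nonneg (by linarith) 3
    rw [ih μ, volume_superlevel_swirl_dss_step hns hax hL hl hdss hτ ((l ^ ρ) ^ k * μ), ← mul_assoc, ← mul_assoc,
      ← ENNReal.ofReal_mul (pow_nonneg hl3 k), ← pow_succ, ← pow_succ']

/-- **`k` DSS steps down: `m(l^{−kρ} μ) = l^{3k} · m(μ)`.** [folklore] -/
theorem volume_superlevel_swirl_dss_iterate_down {ρ : ℝ} (hns : IsClassicalNSSolutionOn (Iio 0) 0 0 u p)
    (hax : ∀ τ : ℝ, τ < 0 → IsAxisymmetric (u τ)) (hL : ODE.IsUniformlyLipschitzOn u (Iio 0))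
    {l : ℝ} (hl : 1 < l) (hdss : ∀ τ : ℝ, τ < 0 → ∀ y, u τ y = (l ^ (1 + ρ)) • u ((l ^ (2 + ρ)) * τ) (l • y))
    {τ : ℝ} (hτ : τ < 0) (k : ℕ) (μ : ℝ) :
    volume {y : EuclideanSpace ℝ (Fin 3) | ((l ^ ρ) ^ k)⁻¹ * μ < |swirl (u τ) y|} =
      ENNReal.ofReal ((l ^ (3 : ℕ)) ^ k) * volume {y : EuclideanSpace ℝ (Fin 3) | μ < |swirl (u τ) y|} := by
  have hlρk : (l ^ ρ) ^ k ≠ 0 := pow_ne_zero _ (Real.rpow_pos_of_pos (by linarith) _).ne'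
  rw [volume_superlevel_swirl_dss_iterate hns hax hL hl hdss hτ k (((l ^ ρ) ^ k)⁻¹ * μ), ← mul_assoc, mul_inv_cancel₀ hlρk, one_mul]

/-! ### The kills -/

/-- **Geometric ratchet ⇒ null**: if `b^k · v ≤ I` for every `k : ℕ` with `b > 1` and `I < ∞`, then `v = 0`. [folklore] -/
theorem eq_zero_of_geometric_ratchet {v I : ℝ≥0∞} {b : ℝ} (hb : 1 < b) (hI : I ≠ ⊤)
    (h : ∀ k : ℕ, ENNReal.ofReal (b ^ k) * v ≤ I) : v = 0 := by
  by_contra hv0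
  have hvI : v ≤ I := by simpa only [pow_zero, ENNReal.ofReal_one, one_mul] using h 0
  have hvtop : v ≠ ⊤ := ne_top_of_le_ne_top hI hvI
  have hvpos : 0 < v.toReal := ENNReal.toReal_pos hv0 hvtop
  obtain ⟨k, hk⟩ := pow_unbounded_of_one_lt (I.toReal / v.toReal) hb
  have h1 := ENNReal.toReal_mono hI (h k)
  rw [ENNReal.toReal_mul, ENNReal.toReal_ofReal (pow_nonneg (zero_le_one.trans hb.le) k)] at h1
  have h2 : I.toReal < b ^ k * v.toReal := (div_lt_iff₀ hvpos).1 hk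
  linarith

/-- **FINITE-VOLUME SWIRL SUPPORT ON ONE SLICE ⇒ NO SWIRL ON EVERY SLICE** (classical axisymmetric `l`-DSS member on `(−∞,0)` with the Cauchy–Lipschitz hypotheses):
`l^{3k} m(μ) = m(l^{−kρ}μ) ≤ vol{Γ(τ₀,·) ≠ 0} < ∞` for all `k` ⇒ `m ≡ 0` on `μ > 0` ⇒ `Γ(τ₀,·) ≡ 0` (continuity) ⇒ every slice (slice independence).
[cite: Chae2007CMPEuler, Thm 2.2 + Note added p. 6 (continuous-scaling original)] -/
theorem hasNoSwirl_of_dss_of_finiteSwirlSupport {ρ : ℝ} (hns : IsClassicalNSSolutionOn (Iio 0) 0 0 u p)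
    (hax : ∀ τ : ℝ, τ < 0 → IsAxisymmetric (u τ)) (hL : ODE.IsUniformlyLipschitzOn u (Iio 0))
    {l : ℝ} (hl : 1 < l) (hdss : ∀ τ : ℝ, τ < 0 → ∀ y, u τ y = (l ^ (1 + ρ)) • u ((l ^ (2 + ρ)) * τ) (l • y))
    {τ₀ : ℝ} (hτ₀ : τ₀ < 0) (hfin : volume {y : EuclideanSpace ℝ (Fin 3) | swirl (u τ₀) y ≠ 0} < ⊤) :
    ∀ τ : ℝ, τ < 0 → HasNoSwirl (u τ) := by
  have hl3 : 1 < l ^ (3 : ℕ) := one_lt_pow₀ hl three_ne_zero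
  intro τ hτ
  refine SwirlRatchet.hasNoSwirl_of_null_superlevels (hns.contDiff_velocity hτ).continuous fun μ hμ => ?_
  rw [volume_superlevel_swirl_eq hns hax hL hτ hτ₀ μ]
  refine eq_zero_of_geometric_ratchet hl3 hfin.ne fun k => ?_
  rw [← volume_superlevel_swirl_dss_iterate_down hns hax hL hl hdss hτ₀ k μ]
  refine measure_mono fun y hy => ?_
  have hpos : 0 < ((l ^ ρ) ^ k)⁻¹ * μ := mul_pos (inv_pos.2 (pow_pos (Real.rpow_pos_of_pos (by linarith) _) k)) hμ
  have hy' : 0 < |swirl (u τ₀) y| := hpos.trans hy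
  exact abs_pos.1 hy'

/-- **ONE FINITE SWIRL CASIMIR OFF THE DSS-CRITICAL EXPONENT ⇒ NO SWIRL ON EVERY SLICE**: `∫⁻ |Γ(τ₀,·)|^q < ∞` for ONE `0 < q` with `qρ ≠ 3` on ONE slice
`τ₀ < 0` of a classical axisymmetric `l`-DSS member (any real `ρ`).  Chebyshev `ν^q m(ν) ≤ I` at the levels `ν = l^{±kρ}μ` and the DSS law give
`μ^q (l^{qρ−3})^k m(μ) ≤ I` (`k ≥ 0`, used when `qρ > 3`) and `μ^q (l^{3−qρ})^k m(μ) ≤ I` (used when `qρ < 3`); either way a geometric ratchet.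
(`q = 3/ρ`: `∫|Γ|^q` is DSS-invariant and nothing follows.) [cite: Chae2007CMPEuler, Thm 2.2 + Note added p. 6 (continuous-scaling original)] -/
theorem hasNoSwirl_of_dss_of_swirl_Lq {ρ : ℝ} (hns : IsClassicalNSSolutionOn (Iio 0) 0 0 u p)
    (hax : ∀ τ : ℝ, τ < 0 → IsAxisymmetric (u τ)) (hL : ODE.IsUniformlyLipschitzOn u (Iio 0))
    {l : ℝ} (hl : 1 < l) (hdss : ∀ τ : ℝ, τ < 0 → ∀ y, u τ y = (l ^ (1 + ρ)) • u ((l ^ (2 + ρ)) * τ) (l • y))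
    {τ₀ : ℝ} (hτ₀ : τ₀ < 0) {q : ℝ} (hq : 0 < q) (hq3 : q * ρ ≠ 3)
    (hI : ∫⁻ y, ENNReal.ofReal (|swirl (u τ₀) y| ^ q) < ⊤) :
    ∀ τ : ℝ, τ < 0 → HasNoSwirl (u τ) := by
  have hl0 : 0 < l := by linarith
  have hlρ : 0 < l ^ ρ := Real.rpow_pos_of_pos hl0 _
  have hU₀c : Continuous (u τ₀) := (hns.contDiff_velocity hτ₀).continuous
  set I : ℝ≥0∞ := ∫⁻ y, ENNReal.ofReal (|swirl (u τ₀) y| ^ q) with hIdef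
  intro τ hτ
  refine SwirlRatchet.hasNoSwirl_of_null_superlevels (hns.contDiff_velocity hτ).continuous fun μ hμ => ?_
  rw [volume_superlevel_swirl_eq hns hax hL hτ hτ₀ μ]
  set v : ℝ≥0∞ := volume {y : EuclideanSpace ℝ (Fin 3) | μ < |swirl (u τ₀) y|} with hv
  have hμq : 0 < μ ^ q := Real.rpow_pos_of_pos hμ _
  -- it suffices to ratchet `ofReal(μ^q) * v`
  suffices hsuff : ENNReal.ofReal (μ ^ q) * v = 0 by
    rcases mul_eq_zero.1 hsuff with h0 | h0
    · exact absurd h0 (ENNReal.ofReal_pos.2 hμq).ne'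
    · exact h0
  -- exponent bookkeeping: `((l^ρ)^k)^q = (l^{qρ})^k`, `l^{(a−b)}` as a quotient, `l^{(3:ℝ)} = l^3`
  have hpowq : ∀ k : ℕ, ((l ^ ρ) ^ k) ^ q = (l ^ (q * ρ)) ^ k := by
    intro k
    rw [← Real.rpow_natCast, ← Real.rpow_natCast, ← Real.rpow_mul hlρ.le, mul_comm (k : ℝ) q, Real.rpow_mul hlρ.le,
      ← Real.rpow_mul hl0.le, mul_comm ρ q]
  have h3 : l ^ (3 : ℝ) = l ^ (3 : ℕ) := by exact_mod_cast Real.rpow_natCast l 3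
  rcases lt_or_gt_of_ne hq3 with hlt | hgt
  · -- `qρ < 3`: levels `l^{−kρ} μ`, ratio `b = l^{3−qρ} > 1`
    have hb : 1 < l ^ (3 - q * ρ) := Real.one_lt_rpow hl (by linarith)
    refine eq_zero_of_geometric_ratchet hb hI.ne fun k => ?_
    have hν : 0 < ((l ^ ρ) ^ k)⁻¹ * μ := mul_pos (inv_pos.2 (pow_pos hlρ k)) hμ
    have hcheb := SwirlRatchet.ofReal_rpow_mul_volume_superlevel_le hU₀c hq hν
    rw [volume_superlevel_swirl_dss_iterate_down hns hax hL hl hdss hτ₀ k μ, ← mul_assoc,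
      ← ENNReal.ofReal_mul (Real.rpow_nonneg hν.le _)] at hcheb
    have hA : (l ^ (3 - q * ρ)) ^ k = (l ^ (3 : ℕ)) ^ k / (l ^ (q * ρ)) ^ k := by
      rw [← div_pow, Real.rpow_sub hl0, h3]
    have hB : (((l ^ ρ) ^ k)⁻¹ * μ) ^ q = μ ^ q / (l ^ (q * ρ)) ^ k := by
      rw [Real.mul_rpow (inv_nonneg.2 (pow_nonneg hlρ.le k)) hμ.le, Real.inv_rpow (pow_nonneg hlρ.le k), hpowq k,
        inv_mul_eq_div]
    have hreal : (l ^ (3 - q * ρ)) ^ k * μ ^ q = (((l ^ ρ) ^ k)⁻¹ * μ) ^ q * (l ^ (3 : ℕ)) ^ k := by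
      rw [hA, hB]; ring
    calc ENNReal.ofReal ((l ^ (3 - q * ρ)) ^ k) * (ENNReal.ofReal (μ ^ q) * v)
        = ENNReal.ofReal ((l ^ (3 - q * ρ)) ^ k * μ ^ q) * v := by
          rw [← mul_assoc, ← ENNReal.ofReal_mul (pow_nonneg (zero_le_one.trans hb.le) k)]
      _ = ENNReal.ofReal ((((l ^ ρ) ^ k)⁻¹ * μ) ^ q * (l ^ (3 : ℕ)) ^ k) * v := by rw [hreal]
      _ ≤ I := hcheb
  · -- `qρ > 3`: levels `l^{kρ} μ`, ratio `b = l^{qρ−3} > 1`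
    have hb : 1 < l ^ (q * ρ - 3) := Real.one_lt_rpow hl (by linarith)
    refine eq_zero_of_geometric_ratchet hb hI.ne fun k => ?_
    have hν : 0 < (l ^ ρ) ^ k * μ := mul_pos (pow_pos hlρ k) hμ
    have hcheb := SwirlRatchet.ofReal_rpow_mul_volume_superlevel_le hU₀c hq hν
    have hA : (l ^ (q * ρ - 3)) ^ k = (l ^ (q * ρ)) ^ k / (l ^ (3 : ℕ)) ^ k := by
      rw [← div_pow, Real.rpow_sub hl0, h3]
    have hreal : (l ^ (q * ρ - 3)) ^ k * μ ^ q * (l ^ (3 : ℕ)) ^ k = ((l ^ ρ) ^ k * μ) ^ q := by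
      rw [Real.mul_rpow (pow_nonneg hlρ.le k) hμ.le, hpowq k, hA]
      field_simp
    calc ENNReal.ofReal ((l ^ (q * ρ - 3)) ^ k) * (ENNReal.ofReal (μ ^ q) * v)
        = ENNReal.ofReal ((l ^ (q * ρ - 3)) ^ k) * (ENNReal.ofReal (μ ^ q) * (ENNReal.ofReal ((l ^ (3 : ℕ)) ^ k) *
            volume {y : EuclideanSpace ℝ (Fin 3) | (l ^ ρ) ^ k * μ < |swirl (u τ₀) y|})) := by
          rw [hv, volume_superlevel_swirl_dss_iterate hns hax hL hl hdss hτ₀ k μ]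
      _ = ENNReal.ofReal ((l ^ (q * ρ - 3)) ^ k * μ ^ q * (l ^ (3 : ℕ)) ^ k) *
            volume {y : EuclideanSpace ℝ (Fin 3) | (l ^ ρ) ^ k * μ < |swirl (u τ₀) y|} := by
          rw [← mul_assoc, ← mul_assoc, ← ENNReal.ofReal_mul (pow_nonneg (zero_le_one.trans hb.le) k),
            ← ENNReal.ofReal_mul (mul_nonneg (pow_nonneg (zero_le_one.trans hb.le) k) hμq.le)]
      _ = ENNReal.ofReal (((l ^ ρ) ^ k * μ) ^ q) * volume {y : EuclideanSpace ℝ (Fin 3) | (l ^ ρ) ^ k * μ < |swirl (u τ₀) y|} := by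
          rw [hreal]
      _ ≤ I := hcheb

end DSSSwirlRatchet

/-! ### Member forms -/

namespace DSSSwirlRatchet

variable {u : ℝ → EuclideanSpace ℝ (Fin 3) → EuclideanSpace ℝ (Fin 3)} {p : ℝ → EuclideanSpace ℝ (Fin 3) → ℝ}
  {H : ℝ → EuclideanSpace ℝ (Fin 3) → EuclideanSpace ℝ (Fin 3) →L[ℝ] EuclideanSpace ℝ (Fin 3)} {c : ℝ≥0}

/-- **MEMBER FORM: CLASSICAL AXISYMMETRIC DSS MEMBER, SWIRL OF FINITE-VOLUME SUPPORT ON ONE PAST SLICE, `ω_θ/r ∈ L²` ⇒ TRIVIAL** — binders of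
`AxisymNoSwirl.ae_eq_zero_of_gauge_of_axisymNoSwirl_dss` verbatim with its no-swirl clause REPLACED by `∃ τ₀ < 0, vol{y | swirl (u τ₀) y ≠ 0} < ⊤`.
[cite: Chae2007CMPEuler, Thm 2.2 + Note added p. 6] -/
theorem ae_eq_zero_of_gauge_of_axisym_dss_finiteSwirlSupport {ρ : ℝ} (hρ : 0 < ρ)
    (hH : HasWeakSpatialGradientOn (slab (EuclideanSpace ℝ (Fin 3)) (Iio 0) isOpen_Iio) u H)
    (hc : ∀ a : ℝ, 0 < a → ENNReal.ofReal (a ^ (2 * ρ)) * cknA a (0 : ℝ × EuclideanSpace ℝ (Fin 3)) u +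
        ENNReal.ofReal (a ^ ρ) * cknE a (0 : ℝ × EuclideanSpace ℝ (Fin 3)) H +
        ENNReal.ofReal (a ^ (2 * ρ)) * cknD a (0 : ℝ × EuclideanSpace ℝ (Fin 3)) p ≤ (c : ℝ≥0∞))
    (hns : IsClassicalNSSolutionOn (Iio 0) 0 0 u p)
    (hax : ∀ τ : ℝ, τ < 0 → IsAxisymmetric (u τ))
    {l : ℝ} (hl : 1 < l)
    (hdss : ∀ τ : ℝ, τ < 0 → ∀ y, u τ y = (l ^ (1 + ρ)) • u ((l ^ (2 + ρ)) * τ) (l • y))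
    (hbdd : ∀ s t : ℝ, s < t → t < 0 → ∃ B : ℝ, ∀ τ ∈ Icc s t, ∀ y,
      ‖u τ y‖ ≤ B ∧ ‖fderiv ℝ (u τ) y‖ ≤ B)
    (hsupp : ∃ τ₀ : ℝ, τ₀ < 0 ∧ volume {y : EuclideanSpace ℝ (Fin 3) | swirl (u τ₀) y ≠ 0} < ⊤)
    (hL2 : ∀ s t : ℝ, s < t → t < 0 → ∃ N : ℝ, ∀ τ ∈ Icc s t,
      Integrable (fun y => angVortQuot (u τ) y ^ 2) ∧ ∫ y, angVortQuot (u τ) y ^ 2 ≤ N) :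
    uncurry u =ᵐ[volume.restrict (Iio (0 : ℝ) ×ˢ (univ : Set (EuclideanSpace ℝ (Fin 3))))] 0 := by
  obtain ⟨τ₀, hτ₀, hfin⟩ := hsupp
  exact AxisymNoSwirl.ae_eq_zero_of_gauge_of_axisymNoSwirl_dss hρ hH hc hns hax
    (hasNoSwirl_of_dss_of_finiteSwirlSupport hns hax (isUniformlyLipschitzOn_of_bounds hns hbdd) hl hdss hτ₀ hfin) hl hdss hbdd hL2

/-- **MEMBER FORM: CLASSICAL AXISYMMETRIC DSS MEMBER, ONE FINITE SWIRL CASIMIR `∫⁻|r u_θ|^q < ∞` (`0 < q`, `qρ ≠ 3`) ON ONE PAST SLICE, `ω_θ/r ∈ L²` ⇒ TRIVIAL** —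
binders of `AxisymNoSwirl.ae_eq_zero_of_gauge_of_axisymNoSwirl_dss` verbatim with its no-swirl clause REPLACED by
`∃ τ₀ < 0, ∃ q, 0 < q ∧ q * ρ ≠ 3 ∧ ∫⁻ ofReal(|swirl (u τ₀)|^q) < ⊤` (⊇ the v34 clause `∃ k ≥ 1, 2kρ ≠ 3, (r u_θ)^k ∈ L²` uniformly on compact intervals: `q = 2k`, one slice).
[cite: Chae2007CMPEuler, Thm 2.2 + Note added p. 6] -/
theorem ae_eq_zero_of_gauge_of_axisym_dss_swirlCasimir {ρ : ℝ} (hρ : 0 < ρ)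
    (hH : HasWeakSpatialGradientOn (slab (EuclideanSpace ℝ (Fin 3)) (Iio 0) isOpen_Iio) u H)
    (hc : ∀ a : ℝ, 0 < a → ENNReal.ofReal (a ^ (2 * ρ)) * cknA a (0 : ℝ × EuclideanSpace ℝ (Fin 3)) u +
        ENNReal.ofReal (a ^ ρ) * cknE a (0 : ℝ × EuclideanSpace ℝ (Fin 3)) H +
        ENNReal.ofReal (a ^ (2 * ρ)) * cknD a (0 : ℝ × EuclideanSpace ℝ (Fin 3)) p ≤ (c : ℝ≥0∞))
    (hns : IsClassicalNSSolutionOn (Iio 0) 0 0 u p)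
    (hax : ∀ τ : ℝ, τ < 0 → IsAxisymmetric (u τ))
    {l : ℝ} (hl : 1 < l)
    (hdss : ∀ τ : ℝ, τ < 0 → ∀ y, u τ y = (l ^ (1 + ρ)) • u ((l ^ (2 + ρ)) * τ) (l • y))
    (hbdd : ∀ s t : ℝ, s < t → t < 0 → ∃ B : ℝ, ∀ τ ∈ Icc s t, ∀ y,
      ‖u τ y‖ ≤ B ∧ ‖fderiv ℝ (u τ) y‖ ≤ B)
    (hcas : ∃ τ₀ : ℝ, τ₀ < 0 ∧ ∃ q : ℝ, 0 < q ∧ q * ρ ≠ 3 ∧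
      ∫⁻ y, ENNReal.ofReal (|swirl (u τ₀) y| ^ q) < ⊤)
    (hL2 : ∀ s t : ℝ, s < t → t < 0 → ∃ N : ℝ, ∀ τ ∈ Icc s t,
      Integrable (fun y => angVortQuot (u τ) y ^ 2) ∧ ∫ y, angVortQuot (u τ) y ^ 2 ≤ N) :
    uncurry u =ᵐ[volume.restrict (Iio (0 : ℝ) ×ˢ (univ : Set (EuclideanSpace ℝ (Fin 3))))] 0 := by
  obtain ⟨τ₀, hτ₀, q, hq, hq3, hI⟩ := hcas
  exact AxisymNoSwirl.ae_eq_zero_of_gauge_of_axisymNoSwirl_dss hρ hH hc hns hax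
    (hasNoSwirl_of_dss_of_swirl_Lq hns hax (isUniformlyLipschitzOn_of_bounds hns hbdd) hl hdss hτ₀ hq hq3 hI) hl hdss hbdd hL2

end DSSSwirlRatchet

end Summit.NavierStokesRegularity.NavierStokesRegularity.Theorems.PowerGaugeEulerLiouville

end
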